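import Mathlib
import Summits.Ventures.HodgeRepro.Tier4.Target
import Summits.Ventures.HodgeRepro.Tier4.Common.TargetBall
import Summits.Ventures.HodgeRepro.Tier4.Common.AutForms
import Summits.Ventures.HodgeRepro.Tier4.Line3.KMDatum

/-!
# Tier4/Line3/KernelBounds — L3.7, part 1: the sphere lemma, continuity and the elementary bounds of the datum

Blind re-derivation cell `pub-hodge-repro`, Tier 4 «PROVE THE STEP» (README §9–§10), LINE L3 (orbit expansion of the
quadruple theta period; skeleton `Tier4/Line3/Skeleton.lean` v0.7 4b06d5d1… L749–L755 `kernel_integral_pos`), seat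
t4-L3-p1 (prover), assigned by the lead (STATUS S12104).  Part 1 of the proof of L3.7; part 2 (the bound of the wedge on
the ball and the theorem) is `Tier4/Line3/KernelIntegralPos.lean`.

CONTENT.
1. `(star (lift3 z) ⬝ᵥ (J *ᵥ y)) = w_z^* J y` (`w_z = lift3 z` the lift of `z`), its coordinates and continuity.
2. THE SPHERE LEMMA `lift3_dot_ne_zero_of_nsq_eq_one`: if `ya, yb` span a `J`-positive plane (every non-zero `u ya + v yb` has
   `quadJ > 0`) then no `z` on the sphere `nsq z = 1` has `(star (lift3 z) ⬝ᵥ (J *ᵥ ya)) = (star (lift3 z) ⬝ᵥ (J *ᵥ yb)) = 0` — an isotropic lift `J`-orthogonal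
   to the plane would give, by Cramer on the first two coordinates (`det_ne_zero_of_pos`), a non-zero vector
   `u ya + v yb` of the plane with `quadJ = 0`.  Hence (`exists_pos_le_phi_add`, compactness of the closed ball) the
   continuous function `φ z + (1 − nsq z)`, `φ = ‖w_z^* J ya‖² + ‖w_z^* J yb‖²`, has a positive lower bound `c` on the closed
   ball: `φ ≥ c/2` on the annulus `1 − nsq z ≤ c/2`.
3. Continuity on the open ball of `maj y`, `z ↦ ȳ ⬝ ℓ z k`, `datum Φ y · k` and the wedge `Φ(ya) ∧ Φ(yb)`.
4. The elementary bounds: `‖ȳ ⬝ v‖ ≤ (Σ ‖y i‖) · max ‖v i‖`, `‖datum‖ = ‖ȳ ⬝ ℓ‖ · e^{−π maj}`,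
   `maj ya z + maj yb z = quadJ ya + quadJ yb + 2 φ z / (1 − nsq z)`, and `(1/s^m)² e^{−c/s} ≤ M` on `0 < s ≤ 1`
   (the Gaussian beats any power: `exp x ≥ x^n / n!`).

Imports: Mathlib, `Tier4/Target.lean`, the landed Common modules `TargetBall` (`quadJ`) and `AutForms`
(`continuous_nsq`, `isOpen_ball`), and `Tier4/Line3/KMDatum.lean` (`maj`, `KMDatum`, `datum`).  No literature input.
Nothing here asserts anything about the truth of (P); HC_CM is NOT proved by anyone in this repository.
-/

set_option autoImplicit false

noncomputable section

namespace Summit.Ventures.HodgeRepro.Tier4.Line3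

open Summit.Ventures.HodgeRepro.Tier4
open Matrix MeasureTheory
open scoped ComplexConjugate

/-! ## 1. The boundary pairing `w_z^* J y` and the sphere lemma -/

/-- The boundary pairing `w_z^* J y` (`w_z = lift3 z = (z, 1)`) in coordinates:
`w_z^* J y = conj(z₀) y₀ + conj(z₁) y₁ − y₂`. -/
theorem lift3_dot_eq (y : Fin 3 → ℂ) (z : Fin 2 → ℂ) :
    (star (lift3 z) ⬝ᵥ (J *ᵥ y)) = conj (z 0) * y 0 + conj (z 1) * y 1 - y 2 := by
  simp only [lift3, J, mulVec_diagonal, dotProduct, Fin.sum_univ_three, Pi.star_apply,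
    Complex.star_def, Matrix.cons_val_zero, Matrix.cons_val_one, Matrix.cons_val, map_one]
  ring

/-- The boundary pairing `z ↦ w_z^* J y` is continuous. -/
theorem continuous_lift3_dot (y : Fin 3 → ℂ) :
    Continuous (fun z : Fin 2 → ℂ => (star (lift3 z) ⬝ᵥ (J *ᵥ y))) := by
  have h : (fun z : Fin 2 → ℂ => (star (lift3 z) ⬝ᵥ (J *ᵥ y))) =
      fun z => conj (z 0) * y 0 + conj (z 1) * y 1 - y 2 := funext (lift3_dot_eq y)
  rw [h]
  fun_prop

/-- `quadJ` of a vector in the plane, as the real part of the `J`-form (the form of `hpos`). -/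
theorem quadJ_eq_re (w : Fin 3 → ℂ) : (star w ⬝ᵥ (J *ᵥ w)).re = quadJ w := by
  rw [star_dotProduct_J_mulVec, Complex.ofReal_re]

/-- The first two ball coordinates of `ya, yb` are independent when the plane is `J`-positive (a vector of the plane
with vanishing first two coordinates has `J`-norm `≤ 0`). -/
theorem det_ne_zero_of_pos (ya yb : Fin 3 → ℂ)
    (hpos : ∀ u v : ℂ, (u ≠ 0 ∨ v ≠ 0) → 0 < quadJ (u • ya + v • yb)) :
    ya 0 * yb 1 - ya 1 * yb 0 ≠ 0 := by
  intro hD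
  -- a non-zero `(u, v)` with `u ya + v yb` vanishing in the first two coordinates
  have key : ∃ u v : ℂ, (u ≠ 0 ∨ v ≠ 0) ∧ (u • ya + v • yb) 0 = 0 ∧ (u • ya + v • yb) 1 = 0 := by
    by_cases h1 : ya 1 = 0 ∧ yb 1 = 0
    · by_cases h0 : ya 0 = 0 ∧ yb 0 = 0
      · refine ⟨1, 0, Or.inl one_ne_zero, ?_, ?_⟩ <;> simp [h0.1, h1.1]
      · refine ⟨yb 0, -ya 0, ?_, ?_, ?_⟩
        · by_contra hc
          exact h0 ⟨by_contra fun h => hc (Or.inr (neg_ne_zero.mpr h)), by_contra fun h => hc (Or.inl h)⟩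
        · simp only [Pi.add_apply, Pi.smul_apply, smul_eq_mul]; ring
        · simp only [Pi.add_apply, Pi.smul_apply, smul_eq_mul, h1.1, h1.2]; ring
    · refine ⟨yb 1, -ya 1, ?_, ?_, ?_⟩
      · by_contra hc
        exact h1 ⟨by_contra fun h => hc (Or.inr (neg_ne_zero.mpr h)), by_contra fun h => hc (Or.inl h)⟩
      · simp only [Pi.add_apply, Pi.smul_apply, smul_eq_mul]; linear_combination hD
      · simp only [Pi.add_apply, Pi.smul_apply, smul_eq_mul]; ring
  obtain ⟨u, v, huv, h0, h1⟩ := key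
  have hq := hpos u v huv
  simp only [quadJ, h0, h1, norm_zero] at hq
  nlinarith [sq_nonneg ‖(u • ya + v • yb) 2‖]

/-- **THE SPHERE LEMMA**: on the sphere `nsq z = 1` the lift `w_z` is isotropic, and it cannot be `J`-orthogonal to a
`J`-positive plane: one of `w_z^* J ya`, `w_z^* J yb` is non-zero. -/
theorem lift3_dot_ne_zero_of_nsq_eq_one (ya yb : Fin 3 → ℂ)
    (hpos : ∀ u v : ℂ, (u ≠ 0 ∨ v ≠ 0) → 0 < quadJ (u • ya + v • yb))
    (z : Fin 2 → ℂ) (hz : nsq z = 1) :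
    (star (lift3 z) ⬝ᵥ (J *ᵥ ya)) ≠ 0 ∨ (star (lift3 z) ⬝ᵥ (J *ᵥ yb)) ≠ 0 := by
  by_contra hc
  have hA : (star (lift3 z) ⬝ᵥ (J *ᵥ ya)) = 0 := by_contra fun h => hc (Or.inl h)
  have hB : (star (lift3 z) ⬝ᵥ (J *ᵥ yb)) = 0 := by_contra fun h => hc (Or.inr h)
  rw [lift3_dot_eq] at hA hB
  have hD := det_ne_zero_of_pos ya yb hpos
  set D := ya 0 * yb 1 - ya 1 * yb 0 with hDdef
  -- Cramer: `u ya + v yb` has first two coordinates `D z`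
  set u : ℂ := z 0 * yb 1 - z 1 * yb 0 with hu
  set v : ℂ := ya 0 * z 1 - ya 1 * z 0 with hv
  have hw0 : (u • ya + v • yb) 0 = D * z 0 := by
    simp only [Pi.add_apply, Pi.smul_apply, smul_eq_mul, hu, hv, hDdef]; ring
  have hw1 : (u • ya + v • yb) 1 = D * z 1 := by
    simp only [Pi.add_apply, Pi.smul_apply, smul_eq_mul, hu, hv, hDdef]; ring
  -- the unit-sphere identity `conj z₀ z₀ + conj z₁ z₁ = 1`
  have hsph : conj (z 0) * z 0 + conj (z 1) * z 1 = 1 := by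
    rw [Complex.conj_mul', Complex.conj_mul']
    have : ((nsq z : ℝ) : ℂ) = 1 := by rw [hz]; norm_num
    rw [← this]
    simp [nsq]
  have hw2 : (u • ya + v • yb) 2 = D := by
    simp only [Pi.add_apply, Pi.smul_apply, smul_eq_mul, hu, hv, hDdef]
    linear_combination (-(z 0 * yb 1 - z 1 * yb 0)) * hA + (-(ya 0 * z 1 - ya 1 * z 0)) * hB +
      (ya 0 * yb 1 - ya 1 * yb 0) * hsph
  -- `(u, v) ≠ 0` since `D z ≠ 0`
  have huv : u ≠ 0 ∨ v ≠ 0 := by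
    by_contra hc
    have hu0 : u = 0 := by_contra fun h => hc (Or.inl h)
    have hv0 : v = 0 := by_contra fun h => hc (Or.inr h)
    have h0 : D * z 0 = 0 := by rw [← hw0, hu0, hv0]; simp
    have h1 : D * z 1 = 0 := by rw [← hw1, hu0, hv0]; simp
    have hz0 : z 0 = 0 := (mul_eq_zero.mp h0).resolve_left hD
    have hz1 : z 1 = 0 := (mul_eq_zero.mp h1).resolve_left hD
    simp [nsq, hz0, hz1] at hz
  have hq := hpos u v huv
  simp only [quadJ, hw0, hw1, hw2, norm_mul, mul_pow] at hq
  have hnsq : ‖z 0‖ ^ 2 + ‖z 1‖ ^ 2 = 1 := hz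
  nlinarith [sq_nonneg ‖D‖]

/-! ## 2. The uniform lower bound near the boundary -/

/-- `φ z = ‖w_z^* J ya‖² + ‖w_z^* J yb‖²` is continuous. -/
theorem continuous_phi (ya yb : Fin 3 → ℂ) :
    Continuous (fun z : Fin 2 → ℂ =>
      (‖star (lift3 z) ⬝ᵥ (J *ᵥ ya)‖ ^ 2 + ‖star (lift3 z) ⬝ᵥ (J *ᵥ yb)‖ ^ 2)) :=
  ((continuous_lift3_dot ya).norm.pow 2).add ((continuous_lift3_dot yb).norm.pow 2)

/-- The closed ball `{nsq z ≤ r}` is compact for `r ≤ 1` (closed and bounded in `ℂ²`). -/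
theorem isCompact_nsq_le (r : ℝ) (hr : r ≤ 1) : IsCompact {z : Fin 2 → ℂ | nsq z ≤ r} := by
  refine Metric.isCompact_of_isClosed_isBounded (isClosed_le continuous_nsq continuous_const) ?_
  refine (Metric.isBounded_closedBall (x := (0 : Fin 2 → ℂ)) (r := 1)).subset fun z hz => ?_
  simp only [nsq, Set.mem_setOf_eq] at hz
  have hz1 : ‖z 0‖ ^ 2 + ‖z 1‖ ^ 2 ≤ 1 := hz.trans hr
  rw [Metric.mem_closedBall, dist_zero_right, pi_norm_le_iff_of_nonneg zero_le_one]
  intro i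
  have h0 : 0 ≤ ‖z 0‖ ^ 2 := sq_nonneg _
  have h1 : 0 ≤ ‖z 1‖ ^ 2 := sq_nonneg _
  have : ‖z i‖ ^ 2 ≤ 1 := by fin_cases i <;> simp <;> nlinarith
  nlinarith [norm_nonneg (z i)]

/-- **THE UNIFORM BOUND**: `φ z + (1 − nsq z) ≥ c > 0` on the closed ball. -/
theorem exists_pos_le_phi_add (ya yb : Fin 3 → ℂ)
    (hpos : ∀ u v : ℂ, (u ≠ 0 ∨ v ≠ 0) → 0 < quadJ (u • ya + v • yb)) :
    ∃ c : ℝ, 0 < c ∧ ∀ z : Fin 2 → ℂ, nsq z ≤ 1 →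
      c ≤ (‖star (lift3 z) ⬝ᵥ (J *ᵥ ya)‖ ^ 2 + ‖star (lift3 z) ⬝ᵥ (J *ᵥ yb)‖ ^ 2) + (1 - nsq z) := by
  have hcont : ContinuousOn
      (fun z => (‖star (lift3 z) ⬝ᵥ (J *ᵥ ya)‖ ^ 2 + ‖star (lift3 z) ⬝ᵥ (J *ᵥ yb)‖ ^ 2) + (1 - nsq z))
      {z : Fin 2 → ℂ | nsq z ≤ 1} :=
    ((continuous_phi ya yb).add (continuous_const.sub continuous_nsq)).continuousOn
  have hpos' : ∀ z ∈ {z : Fin 2 → ℂ | nsq z ≤ 1},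
      (0 : ℝ) < (‖star (lift3 z) ⬝ᵥ (J *ᵥ ya)‖ ^ 2 + ‖star (lift3 z) ⬝ᵥ (J *ᵥ yb)‖ ^ 2) + (1 - nsq z) := by
    intro z hz
    simp only [Set.mem_setOf_eq] at hz
    rcases lt_or_eq_of_le hz with hlt | heq
    · have : 0 ≤ (‖star (lift3 z) ⬝ᵥ (J *ᵥ ya)‖ ^ 2 + ‖star (lift3 z) ⬝ᵥ (J *ᵥ yb)‖ ^ 2) :=
        add_nonneg (sq_nonneg _) (sq_nonneg _)
      linarith
    · rw [heq, sub_self, add_zero]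
      rcases lift3_dot_ne_zero_of_nsq_eq_one ya yb hpos z heq with h | h
      · have : 0 < ‖(star (lift3 z) ⬝ᵥ (J *ᵥ ya))‖ ^ 2 := by positivity
        have : 0 ≤ ‖(star (lift3 z) ⬝ᵥ (J *ᵥ yb))‖ ^ 2 := sq_nonneg _
        linarith
      · have : 0 < ‖(star (lift3 z) ⬝ᵥ (J *ᵥ yb))‖ ^ 2 := by positivity
        have : 0 ≤ ‖(star (lift3 z) ⬝ᵥ (J *ᵥ ya))‖ ^ 2 := sq_nonneg _
        linarith
  obtain ⟨c, hc, hle⟩ := (isCompact_nsq_le 1 le_rfl).exists_forall_le' hcont hpos'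
  exact ⟨c, hc, fun z hz => hle z hz⟩

/-! ## 3. Continuity of the datum on the ball -/

section Datum

variable (Φ : KMDatum)

/-- `maj y` is continuous on the ball (`1 − nsq z > 0` there). -/
theorem continuousOn_maj (y : Fin 3 → ℂ) : ContinuousOn (maj y) ball := by
  unfold maj
  refine continuousOn_const.add ?_
  refine ContinuousOn.div (continuousOn_const.mul ((continuous_lift3_dot y).norm.pow 2).continuousOn)
    (continuousOn_const.sub continuous_nsq.continuousOn) ?_
  intro z hz
  exact ne_of_gt (sub_pos.mpr hz)

/-- `z ↦ ȳ ⬝ ℓ z k` is continuous on the ball. -/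
theorem continuousOn_star_dotProduct_ℓ (y : Fin 3 → ℂ) (k : Fin 2) :
    ContinuousOn (fun z => star y ⬝ᵥ Φ.ℓ z k) ball := by
  simp only [dotProduct]
  exact continuousOn_finsetSum _ fun i _ => continuousOn_const.mul (Φ.cont k i)

/-- `datum Φ y · k` is continuous on the ball. -/
theorem continuousOn_datum (y : Fin 3 → ℂ) (k : Fin 2) :
    ContinuousOn (fun z => datum Φ y z k) ball := by
  unfold datum
  exact (continuousOn_star_dotProduct_ℓ Φ y k).mul
    (Complex.continuous_ofReal.comp_continuousOn
      (Real.continuous_exp.comp_continuousOn (continuousOn_const.mul (continuousOn_maj y))))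

/-- The wedge `Φ(ya, z) ∧ Φ(yb, z)` is continuous on the ball. -/
theorem continuousOn_wedge_datum (ya yb : Fin 3 → ℂ) :
    ContinuousOn (fun z => wedge (datum Φ ya z) (datum Φ yb z)) ball := by
  unfold wedge
  exact ((continuousOn_datum Φ ya 0).mul (continuousOn_datum Φ yb 1)).sub
    ((continuousOn_datum Φ ya 1).mul (continuousOn_datum Φ yb 0))

/-! ## 4. Bounds -/

/-- `‖ȳ ⬝ v‖ ≤ (Σ_i ‖y i‖) · M` when every `‖v i‖ ≤ M`. -/
theorem norm_star_dotProduct_le (y v : Fin 3 → ℂ) (M : ℝ) (hv : ∀ i, ‖v i‖ ≤ M) :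
    ‖star y ⬝ᵥ v‖ ≤ (∑ i, ‖y i‖) * M := by
  calc ‖star y ⬝ᵥ v‖ = ‖∑ i, star (y i) * v i‖ := rfl
    _ ≤ ∑ i, ‖star (y i) * v i‖ := norm_sum_le _ _
    _ = ∑ i, ‖y i‖ * ‖v i‖ := by simp only [norm_mul, norm_star]
    _ ≤ ∑ i, ‖y i‖ * M := Finset.sum_le_sum fun i _ => mul_le_mul_of_nonneg_left (hv i) (norm_nonneg _)
    _ = (∑ i, ‖y i‖) * M := by rw [Finset.sum_mul]

/-- The norm of the datum: `‖datum Φ y z k‖ = ‖ȳ ⬝ ℓ z k‖ · exp(−π maj y z)`. -/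
theorem norm_datum (y : Fin 3 → ℂ) (z : Fin 2 → ℂ) (k : Fin 2) :
    ‖datum Φ y z k‖ = ‖star y ⬝ᵥ Φ.ℓ z k‖ * Real.exp (-Real.pi * maj y z) := by
  unfold datum
  rw [norm_mul, Complex.norm_real, Real.norm_eq_abs, abs_of_pos (Real.exp_pos _)]

/-- The majorant sum in terms of `quadJ` and `φ`: `maj ya z + maj yb z = quadJ ya + quadJ yb + 2 φ z / (1 − nsq z)`. -/
theorem maj_add_maj (ya yb : Fin 3 → ℂ) (z : Fin 2 → ℂ) :
    maj ya z + maj yb z = quadJ ya + quadJ yb +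
      2 * (‖star (lift3 z) ⬝ᵥ (J *ᵥ ya)‖ ^ 2 + ‖star (lift3 z) ⬝ᵥ (J *ᵥ yb)‖ ^ 2) / (1 - nsq z) := by
  unfold maj
  rw [quadJ_eq_re, quadJ_eq_re]
  ring

/-- The elementary bound `(1 / s^m)² · exp(−(c / s)) ≤ M` for `0 < s ≤ 1` (the Gaussian beats any power). -/
theorem exists_bound_rpow_exp (m c : ℝ) (hc : 0 < c) :
    ∃ M : ℝ, 0 ≤ M ∧ ∀ s : ℝ, 0 < s → s ≤ 1 → (1 / s ^ m) ^ 2 * Real.exp (-(c / s)) ≤ M := by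
  set N : ℕ := ⌈m⌉₊ with hN
  refine ⟨((2 * N).factorial : ℝ) / c ^ (2 * N), by positivity, fun s hs hs1 => ?_⟩
  have hmN : m ≤ (N : ℝ) := Nat.le_ceil m
  -- `s^N ≤ s^m`
  have h1 : s ^ N ≤ s ^ m := by
    rw [← Real.rpow_natCast]
    exact Real.rpow_le_rpow_of_exponent_ge hs hs1 hmN
  have hsN : 0 < s ^ N := pow_pos hs N
  have hsm : 0 < s ^ m := Real.rpow_pos_of_pos hs m
  have h2 : 1 / s ^ m ≤ 1 / s ^ N := one_div_le_one_div_of_le hsN h1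
  -- `exp(−(c/s)) ≤ (2N)! s^(2N) / c^(2N)`
  have h3 : Real.exp (-(c / s)) ≤ ((2 * N).factorial : ℝ) * s ^ (2 * N) / c ^ (2 * N) := by
    have hcs : 0 ≤ c / s := div_nonneg hc.le hs.le
    have hexp := Real.pow_div_factorial_le_exp (c / s) hcs (2 * N)
    have hpos : 0 < (c / s) ^ (2 * N) / ((2 * N).factorial : ℝ) := by positivity
    rw [Real.exp_neg]
    calc (Real.exp (c / s))⁻¹ ≤ ((c / s) ^ (2 * N) / ((2 * N).factorial : ℝ))⁻¹ :=
          inv_anti₀ hpos hexp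
      _ = ((2 * N).factorial : ℝ) * s ^ (2 * N) / c ^ (2 * N) := by
          rw [div_pow]
          field_simp
  have h4 : 0 ≤ 1 / s ^ m := by positivity
  have h5 : 0 ≤ Real.exp (-(c / s)) := (Real.exp_pos _).le
  calc (1 / s ^ m) ^ 2 * Real.exp (-(c / s))
      ≤ (1 / s ^ N) ^ 2 * (((2 * N).factorial : ℝ) * s ^ (2 * N) / c ^ (2 * N)) := by
        gcongr
    _ = ((2 * N).factorial : ℝ) / c ^ (2 * N) := by
        field_simp
        ring

end Datum

end Summit.Ventures.HodgeRepro.Tier4.Line3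

end
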